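import Literature.NumberTheory.GaloisRepresentations.LocalWeilDatumExtension
import Literature.NumberTheory.GaloisRepresentations.LocalWeilDatumValuation
import HarnessLib

/-!
# The Weil datum of a non-archimedean local field, IX: the valuation of `E` read inside `F̄`

For a finite extension `E/F` of non-archimedean local fields and `E₀ = ι⁻¹(E) ⊆ F̄`
(`LocalWeilDatum.embField`, `equivEmbField : E ≃ₐ[F] E₀`), the valuation ring of `E` corresponds
to the integral closure `O_{E₀}` of `𝒪[F]` in `E₀` (**uniqueness of the extension of the valuation**,
through the spectral description `absClosureEmbedding_mem_absIntegers_iff` of `LocalGaloisGroupProofs`):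

* `mem_integer_iff_isIntegral`: `x ∈ 𝒪[E] ↔ equivEmbField x ∈ O_{E₀}`;
* `integerEquiv : O_{E₀} ≃+* 𝒪[E]`;
* `ord_symm_eq_of_eq_unit_mul_pow`, `ord_norm_eq_inertiaDeg_mul_ord`:
  `ord_F (N_{E₀/F} y) = f(E₀) · ord_E (y)` — the valuation `(1/f_{E}) v_F ∘ N_{E|F}` of Neukirch's datum
  on the field `W_F ∩ G_{E₀}` **is** `ord_E`;
* `residueFieldCard_eq_pow_inertiaDeg`: `q_E = q_F ^ f(E₀)` (so the residue degree of `E/F` is the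
  residue degree of the prime `𝔓 ∩ E₀`).

## References

* J.-P. Serre, *Local Fields*, Ch. II §2 (Prop. 3 and Cor.). [SerreLocalFields1979]
* J. Neukirch, *Algebraic Number Theory*, Ch. II (4.8), Ch. V §1 (`v_K = (1/f_K) v ∘ N`). [NeukirchANT1999]
-/

noncomputable section

open Field IsNonarchimedeanLocalField ValuativeRel
open scoped Pointwise Valued

namespace Literature.NumberTheory.GaloisRepresentations

namespace LocalWeilDatum

open GaloisRepresentations.IsNonarchimedeanLocalField

attribute [local instance] absClosureAlgebra absClosure_isScalarTower

section Local

variable (F E : Type*) [Field F] [ValuativeRel F] [TopologicalSpace F] [IsNonarchimedeanLocalField F]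
  [Field E] [ValuativeRel E] [TopologicalSpace E] [IsNonarchimedeanLocalField E]
  [Algebra F E] [FiniteDimensional F E] [ValuativeExtension F E]

omit [TopologicalSpace E] [IsNonarchimedeanLocalField E] in
/-- `x ∈ 𝒪[E] ↔ x` is integral over `𝒪[E]` (valuation rings are integrally closed). [folklore] -/
theorem mem_integer_iff_isIntegral_self (x : E) : x ∈ 𝒪[E] ↔ IsIntegral 𝒪[E] x := by
  rw [IsIntegrallyClosed.isIntegral_iff]
  constructor
  · intro hx
    exact ⟨⟨x, hx⟩, rfl⟩
  · rintro ⟨y, rfl⟩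
    exact y.2

/-- **Uniqueness of the extension of the valuation**, integrality form: `x ∈ 𝒪[E]` iff the
corresponding element of `E₀ ⊆ F̄` is integral over `𝒪[F]`.
[cite: SerreLocalFields1979, Ch. II §2 Prop. 3] -/
theorem mem_integer_iff_isIntegral (x : E) :
    x ∈ 𝒪[E] ↔ IsIntegral 𝒪[F] (equivEmbField F E x : embField F E) := by
  rw [mem_integer_iff_isIntegral_self,
    ← isIntegral_algHom_iff (IsScalarTower.toAlgHom 𝒪[E] E (AlgebraicClosure E))
      (algebraMap E (AlgebraicClosure E)).injective,
    ← isIntegral_algHom_iff ((embField F E).val.restrictScalars 𝒪[F]) (fun _ _ h => Subtype.ext h)]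
  change IsIntegral 𝒪[E] (algebraMap E (AlgebraicClosure E) x) ↔
    IsIntegral 𝒪[F] ((equivEmbField F E x : embField F E) : AlgebraicClosure F)
  rw [← mem_integralClosure_iff, ← mem_integralClosure_iff]
  change algebraMap E (AlgebraicClosure E) x ∈ absIntegers 𝒪[E] E ↔
    ((equivEmbField F E x : embField F E) : AlgebraicClosure F) ∈ absIntegers 𝒪[F] F
  rw [← absClosureEmbedding_mem_absIntegers_iff (F := F) (E := E)
    ((equivEmbField F E x : embField F E) : AlgebraicClosure F), absClosureEmbedding_equivEmbField]

/-- **`O_{E₀} ≃+* 𝒪[E]`**: the integral closure of `𝒪[F]` in `E₀ ≅ E` is the valuation ring of `E`.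
[cite: SerreLocalFields1979, Ch. II §2 Prop. 3] -/
def integerEquiv : integralClosure 𝒪[F] (embField F E) ≃+* 𝒪[E] where
  toFun c := ⟨(equivEmbField F E).symm (c : embField F E),
    (mem_integer_iff_isIntegral F E _).mpr (by rw [AlgEquiv.apply_symm_apply]; exact c.2)⟩
  invFun x := ⟨equivEmbField F E (x : E), (mem_integer_iff_isIntegral F E _).mp x.2⟩
  left_inv c := Subtype.ext ((equivEmbField F E).apply_symm_apply _)
  right_inv x := Subtype.ext ((equivEmbField F E).symm_apply_apply _)
  map_mul' c c' := Subtype.ext (by simp)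
  map_add' c c' := Subtype.ext (by simp)

/-- `integerEquiv c = e⁻¹ c` in `E`. [folklore] -/
@[simp]
theorem coe_integerEquiv (c : integralClosure 𝒪[F] (embField F E)) :
    ((integerEquiv F E c : 𝒪[E]) : E) = (equivEmbField F E).symm (c : embField F E) :=
  rfl

/-- **`ord_E` read off a uniformiser of `O_{E₀}`**: if `a = u ϖ^k` in `O_{E₀}` (`ϖ` irreducible,
`u` a unit), then `ord_E (e⁻¹ a) = k`. [cite: SerreLocalFields1979, Ch. II §2] -/
theorem ord_symm_eq_of_eq_unit_mul_pow {ϖ : integralClosure 𝒪[F] (embField F E)} (hϖ : Irreducible ϖ)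
    {a : integralClosure 𝒪[F] (embField F E)} {u : (integralClosure 𝒪[F] (embField F E))ˣ} {k : ℕ}
    (hak : a = u * ϖ ^ k) :
    ord E ((equivEmbField F E).symm (a : embField F E)) = k := by
  have hv := Valuation.integer.integers (valuation E)
  have hϖ' : Irreducible (integerEquiv F E ϖ) := (MulEquiv.irreducible_iff (integerEquiv F E)).mpr hϖ
  have hu' : IsUnit (integerEquiv F E (u : integralClosure 𝒪[F] (embField F E))) := (Units.isUnit u).map _
  have hϖ0 : ((integerEquiv F E ϖ : 𝒪[E]) : E) ≠ 0 := fun h => hϖ'.ne_zero (Subtype.ext h)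
  have hu0 : ((integerEquiv F E (u : integralClosure 𝒪[F] (embField F E)) : 𝒪[E]) : E) ≠ 0 := fun h =>
    hu'.ne_zero (Subtype.ext h)
  have h1 : ord E ((integerEquiv F E ϖ : 𝒪[E]) : E) = 1 := ord_eq_one_of_irreducible E hϖ'
  have h0 : ord E ((integerEquiv F E (u : integralClosure 𝒪[F] (embField F E)) : 𝒪[E]) : E) = 0 :=
    (ord_eq_zero_iff E hu0).mpr (hv.isUnit_iff_valuation_eq_one.mp hu')
  rw [← coe_integerEquiv, hak, map_mul, map_pow]
  push_cast
  rw [ord_mul E hu0 (pow_ne_zero _ hϖ0), ord_pow E hϖ0, h0, h1]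
  simp

/-- **The valuation of the datum on the field of `E` is `ord_E`**: for `y ∈ E₀`, `y ≠ 0`,
`ord_F (N_{E₀/F} y) = f(E₀) · ord_E (e⁻¹ y)` (`f(E₀)` the residue degree of `𝔓 ∩ E₀`), i.e.
Neukirch's `v_E = (1/f_E) v_F ∘ N_{E|F}` is the normalised valuation of `E`.
[cite: NeukirchANT1999, Ch. V §1 (`v_K`); SerreLocalFields1979, Ch. II §2 Cor. to Prop. 3] -/
theorem ord_norm_eq_inertiaDeg_mul_ord [Algebra.IsSeparable F E] (y : embField F E) (hy : y ≠ 0) :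
    ord F (Algebra.norm F y) =
      Ideal.inertiaDeg' 𝓂[F] (primeOf F (embField F E)) * ord E ((equivEmbField F E).symm y) := by
  classical
  haveI := finiteDimensional_embField F E
  have hKs : embField F E ≤ sepClosure F := embField_le_sepClosure F E
  haveI := isDiscreteValuationRing_integralClosure' F (embField F E) hKs
  haveI := isFractionRing_integralClosure F (embField F E)
  set O := integralClosure 𝒪[F] (embField F E)
  set f₀ := Ideal.inertiaDeg' 𝓂[F] (primeOf F (embField F E))
  obtain ⟨ϖ, hϖ⟩ := IsDiscreteValuationRing.exists_irreducible O
  obtain ⟨a, b, hb, rfl⟩ := IsFractionRing.div_surjective (A := O) y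
  have hb0 : b ≠ 0 := nonZeroDivisors.ne_zero hb
  have hb0' : (algebraMap O (embField F E) b) ≠ 0 := fun h => hb0 (Subtype.ext h)
  have ha0' : (algebraMap O (embField F E) a) ≠ 0 := by
    intro h
    apply hy
    rw [h, zero_div]
  have ha0 : a ≠ 0 := fun h => ha0' (by rw [h, map_zero])
  obtain ⟨ka, ua, hka⟩ := IsDiscreteValuationRing.eq_unit_mul_pow_irreducible ha0 hϖ
  obtain ⟨kb, ub, hkb⟩ := IsDiscreteValuationRing.eq_unit_mul_pow_irreducible hb0 hϖ
  have he0 : ∀ {z : embField F E}, z ≠ 0 → (equivEmbField F E).symm z ≠ 0 := fun hz h =>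
    hz ((equivEmbField F E).symm.injective (by rw [h, map_zero]))
  -- multiplicativity: `y · b = a`
  have hNy : ord F (Algebra.norm F (algebraMap O (embField F E) a / algebraMap O (embField F E) b)) +
      ord F (Algebra.norm F (algebraMap O (embField F E) b)) = ord F (Algebra.norm F (algebraMap O (embField F E) a)) := by
    rw [← ord_mul F (Algebra.norm_ne_zero_iff.mpr hy) (Algebra.norm_ne_zero_iff.mpr hb0'), ← map_mul,
      div_mul_cancel₀ _ hb0']
  have hEy : ord E ((equivEmbField F E).symm (algebraMap O (embField F E) a / algebraMap O (embField F E) b)) +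
      ord E ((equivEmbField F E).symm (algebraMap O (embField F E) b)) =
        ord E ((equivEmbField F E).symm (algebraMap O (embField F E) a)) := by
    rw [← ord_mul E (he0 hy) (he0 hb0'), ← map_mul, div_mul_cancel₀ _ hb0']
  rw [show algebraMap O (embField F E) a = (a : embField F E) from rfl,
    show algebraMap O (embField F E) b = (b : embField F E) from rfl] at hNy hEy ⊢
  rw [ord_norm_eq_of_eq_unit_mul_pow F (embField F E) hKs hϖ hka,
    ord_norm_eq_of_eq_unit_mul_pow F (embField F E) hKs hϖ hkb] at hNy
  rw [ord_symm_eq_of_eq_unit_mul_pow F E hϖ hka, ord_symm_eq_of_eq_unit_mul_pow F E hϖ hkb] at hEy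
  linear_combination hNy - (f₀ : ℤ) * hEy

/-- Units of `E` correspond to units of `O_{E₀}`: `ord_E (e⁻¹ c) = 0 ↔ c` is a unit, for `c ∈ O_{E₀}`
non-zero. [folklore] -/
theorem ord_symm_eq_zero_iff (c : integralClosure 𝒪[F] (embField F E)) (hc : c ≠ 0) :
    ord E ((equivEmbField F E).symm (c : embField F E)) = 0 ↔ IsUnit c := by
  have hc' : ((integerEquiv F E c : 𝒪[E]) : E) ≠ 0 := fun h =>
    hc ((map_eq_zero_iff _ (integerEquiv F E).injective).mp (Subtype.ext h))
  rw [← coe_integerEquiv, ord_eq_zero_iff E hc', ← isUnit_map_iff (integerEquiv F E) c,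
    (Valuation.integer.integers (valuation E)).isUnit_iff_valuation_eq_one]
  rfl

/-- **`q_E = q_F ^ f(E₀)`**: the residue field of `E` is `O_{E₀}/𝔓_{E₀}` (through `integerEquiv`),
of cardinality `q_F ^ f`. [cite: SerreLocalFields1979, Ch. II §2; Ch. I §4 Prop. 10] -/
theorem residueFieldCard_eq_pow_inertiaDeg :
    residueFieldCard E = residueFieldCard F ^ Ideal.inertiaDeg' 𝓂[F] (primeOf F (embField F E)) := by
  classical
  haveI := finiteDimensional_embField F E
  haveI := isMaximal_primeOf F (embField F E)
  set O := integralClosure 𝒪[F] (embField F E)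
  -- `integerEquiv` carries `𝔓_{E₀}` (the maximal ideal of the local ring `O`) to `𝓂[E]`
  have hmap : 𝓂[E] = (primeOf F (embField F E)).map (integerEquiv F E : O →+* 𝒪[E]) := by
    have hmax : ((primeOf F (embField F E)).map (integerEquiv F E : O →+* 𝒪[E])).IsMaximal :=
      (Ideal.isMaximal_map_iff_of_bijective (integerEquiv F E : O →+* 𝒪[E]) (integerEquiv F E).bijective).mpr
        inferInstance
    exact (IsLocalRing.eq_maximalIdeal hmax).symm
  have e := Ideal.quotientEquiv (primeOf F (embField F E)) 𝓂[E] (integerEquiv F E) hmap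
  rw [← card_quotient_primeOf F (embField F E)]
  exact (Nat.card_congr e.toEquiv).symm

end Local

end LocalWeilDatum

end Literature.NumberTheory.GaloisRepresentations
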